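import Summits.MatrixMultiplication.MatrixMultiplication.Theorems.AbelianSTPPCensusVPAssemblyHolds
import Summits.MatrixMultiplication.MatrixMultiplication.Theorems.AbelianSTPPCensusVPGrynkiewiczWeak
import Summits.MatrixMultiplication.MatrixMultiplication.Theorems.AbelianSTPPCensusVPShapeExclusionVP337

/-!
# Rung leaf F-M1.T_E/337 — CLOSED: no abelian STPP host of order ≤ 337 beats exponent 5/2

Cell mm-stpp, route `AbelianSTPPCensusVP` (all three items proved, 2026-08-26).  The named, unconditional kernel
theorem `noAbelianSTPPHost_250_337 : NoAbelianSTPPHost_250_337` — the route's deciding theorem: for every finite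
abelian group `H` with `|H| ≤ 337` and every STPP family `(A_i, B_i, C_i)_{i<N}` in `H` (CKSU 2005 Def. 5.1, tree
`IsSTPP`), `Σ_i (|A_i||B_i||C_i|)^{5/6} ≤ |H|` — so no such host certifies `ω < 5/2` through the Cohn–Umans / CKSU
packing bound.  One line over the tree: the assembly `AssemblyVP_proof` (p427251: vM sieve soundness, U11-G soundness
from the weak Grynkiewicz form, U11-P = Pollard at prime orders) applied to the two cruxes `GrynkiewiczWeak_proof`
([Gry10] Thms 1.1/1.2, Literature) and `ShapeExclusionVP337_proof` (the vP shape exclusion: vM certificate `ShapeCert`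
up to 127 plus the eleven U11-G residual kills, and the vP kernel certificate `ShapeCertVP` on `128 ≤ M ≤ 337`,
210 `decide`-class kernel evaluations, p447909).  Extends the leaf T_E/127 (`noAbelianSTPPHost_250_127`).

WHAT THIS IS NOT: no bound on `ω`; a rung leaf (D-0061 ALT-CLOSER, class «rung leaf»), never summit credit; nothing
about orders `≥ 338` (the shape-level statement `ShapeExclusionVP337` is sharp: a beating vP-admissible shape list
exists at order 338).
-/

set_option linter.dupNamespace false -- `MatrixMultiplication.MatrixMultiplication` (summit = problem, D-0017)

namespace Summit.MatrixMultiplication.MatrixMultiplication.Theorems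

/-- **Rung leaf T_E/337 (closed).** No finite abelian group of order at most `337` hosts an STPP family beating
exponent `5/2`: `Σ_i (|A_i||B_i||C_i|)^{5/6} ≤ |H|` for every STPP family in every such `H`. [original] -/
theorem noAbelianSTPPHost_250_337 : NoAbelianSTPPHost_250_337 :=
  AssemblyVP_proof GrynkiewiczWeak_proof ShapeExclusionVP337_proof

end Summit.MatrixMultiplication.MatrixMultiplication.Theorems
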